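import Summits.HubbardSuperconductivity.HubbardSuperconductivity.Theorems.BalabanIRBirSliceXYOrderRPGeometry
import HarnessLib

/-!
# Slice order of the anisotropic XY torus (route BalabanIR, support item `BirSliceXYOrderRP`):
# II. Gaussian domination on the product torus

Second file of the proof of
`Summit.HubbardSuperconductivity.HubbardSuperconductivity.Theses.BalabanIR.BirSliceXYOrderRP`.
Gaussian domination `Z(h) ≤ Z(0)` (Friedli–Velenik 2017, Prop. 10.27, eq. (10.43)) is proved for
any finite graph every bond of which is bisected by a reflection satisfying the four hypotheses of
the tree's reflection-positivity lemma `NVector.vZ_sq_le_reflect` (descent on the number of bad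
bonds over the finite set of fields with values in the range of `h`, as in the tree's cubic-torus
`NVector.vZ_le_vZ_zero`), and then specialised to the box product `(ℤ/L)^d × (ℤ/M)^{d'}` of two
even tori (`L, M ≥ 4`) using the lifted reflections of file I.

## References
* S. Friedli, Y. Velenik, *Statistical Mechanics of Lattice Systems*, CUP 2017, §10.5.3,
  Prop. 10.27, Lemma 10.28. [FriedliVelenik2017]
* T. Kennedy, E. H. Lieb, B. S. Shastry, J. Stat. Phys. 53 (1988) 1019–1030 (finite descent).
-/

namespace Summit.HubbardSuperconductivity.HubbardSuperconductivity.Theorems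

namespace BirSliceXY

open Finset Literature.Probability.LatticeModels

/-! ### Gaussian domination by descent on the number of bad bonds, for a graph all of whose
bonds are bisected by reflections -/

section Descent

open MeasureTheory

variable {V : Type*} [Fintype V] [DecidableEq V] {G : SimpleGraph V} [DecidableRel G.Adj] {ν : ℕ}

/-- **The descent step** (Friedli–Velenik 2017, proof of Prop. 10.27, p. 505, in the finite form of
Kennedy–Lieb–Shastry used by the tree's `NVector.vZ_le_vZ_zero`): if `g` maximises `Z` on a finite
set `F` of fields containing the symmetrisations `g⁺, g⁻` of `g` for a reflection `(θ, 𝕋₊)`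
satisfying the hypotheses of reflection positivity, and `g` has the fewest bad bonds among the
maximisers in `F`, then no crossing bond `{y, θy}` is bad: `Z(g)² ≤ Z(g⁺)Z(g⁻)` forces `g⁺, g⁻` to
be maximisers, while a bad crossing bond would give `N(g⁺) + N(g⁻) ≤ 2N(g) - 2`. [cite: FriedliVelenik2017, §10.5.3, proof of Prop. 10.27] -/
theorem apply_eq_of_crossing (ρ : Measure (Fin ν → ℝ)) [IsFiniteMeasure ρ]
    {K : Set (Fin ν → ℝ)} (hKc : IsCompact K) (hK : ρ Kᶜ = 0) (hρ : ρ ≠ 0) {β : ℝ} (hβ : 0 ≤ β)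
    {θ : V ≃ V} {P : Finset V} (hθ : ∀ x, θ (θ x) = x)
    (hadj : ∀ x y, G.Adj (θ x) (θ y) ↔ G.Adj x y) (hP : ∀ x, x ∈ P ↔ θ x ∉ P)
    (hcross : ∀ x y, x ∈ P → y ∉ P → G.Adj x y → y = θ x)
    {F : Finset (V → Fin ν → ℝ)} {g : V → Fin ν → ℝ}
    (hPF : NVector.reflPlus θ P g ∈ F) (hMF : NVector.reflMinus θ P g ∈ F)
    (hgmax : ∀ g' ∈ F, NVector.vZ G ρ β g' ≤ NVector.vZ G ρ β g)
    (hgmin : ∀ g' ∈ F, NVector.vZ G ρ β g' = NVector.vZ G ρ β g →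
      NVector.vbadBonds G g ≤ NVector.vbadBonds G g')
    {y : V} (hyP : y ∈ P) (hy : G.Adj y (θ y)) : g y = g (θ y) := by
  by_contra hne
  have hsq := NVector.vZ_sq_le_reflect (G := G) hθ hadj hP hcross ρ hKc hK hβ g
  have hPle := hgmax _ hPF
  have hMle := hgmax _ hMF
  have hZpos := NVector.vZ_pos (G := G) hρ hβ g
  have hPpos := NVector.vZ_pos (G := G) hρ hβ (NVector.reflPlus θ P g)
  have hMpos := NVector.vZ_pos (G := G) hρ hβ (NVector.reflMinus θ P g)
  have hPeq : NVector.vZ G ρ β (NVector.reflPlus θ P g) = NVector.vZ G ρ β g := by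
    refine le_antisymm hPle ?_
    by_contra hlt
    have hlt' : NVector.vZ G ρ β (NVector.reflPlus θ P g) < NVector.vZ G ρ β g := lt_of_not_ge hlt
    have : NVector.vZ G ρ β (NVector.reflPlus θ P g) * NVector.vZ G ρ β (NVector.reflMinus θ P g) <
        NVector.vZ G ρ β g * NVector.vZ G ρ β g :=
      mul_lt_mul hlt' hMle hMpos hZpos.le
    nlinarith
  have hMeq : NVector.vZ G ρ β (NVector.reflMinus θ P g) = NVector.vZ G ρ β g := by
    refine le_antisymm hMle ?_
    by_contra hlt
    have hlt' : NVector.vZ G ρ β (NVector.reflMinus θ P g) < NVector.vZ G ρ β g := lt_of_not_ge hlt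
    have : NVector.vZ G ρ β (NVector.reflPlus θ P g) * NVector.vZ G ρ β (NVector.reflMinus θ P g) <
        NVector.vZ G ρ β g * NVector.vZ G ρ β g :=
      mul_lt_mul' hPle hlt' hMpos.le hZpos
    nlinarith
  have hPmin := hgmin _ hPF hPeq
  have hMmin := hgmin _ hMF hMeq
  have hcount := NVector.vbadBonds_reflPlus_add_reflMinus (G := G) hθ hadj hP hcross g
  have hycross : y ∈ crossSites G θ P := Finset.mem_filter.2 ⟨hyP, hy⟩
  have hone : (1 : ℕ) ≤ ∑ z ∈ crossSites G θ P, NVector.vbadInd g s(z, θ z) := by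
    calc (1 : ℕ) = NVector.vbadInd g s(y, θ y) := by rw [NVector.vbadInd_mk, if_neg hne]
      _ ≤ ∑ z ∈ crossSites G θ P, NVector.vbadInd g s(z, θ z) :=
        Finset.single_le_sum (f := fun z => NVector.vbadInd g s(z, θ z)) (fun z _ => Nat.zero_le _)
          hycross
  omega

/-- **Gaussian domination `Z(h) ≤ Z(0)` for a finite graph every bond of which is bisected by a
reflection satisfying the hypotheses of reflection positivity** (Friedli–Velenik 2017,
Prop. 10.27 / eq. (10.43), abstracted from the torus: the printed descent on the number of bad bonds,
run on the finite set of fields with values in the range of `h` as in the tree's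
`NVector.vZ_le_vZ_zero`). [cite: FriedliVelenik2017, Prop. 10.27, eq. (10.43)] -/
theorem vZ_le_vZ_zero_of_reflections (ρ : Measure (Fin ν → ℝ)) [IsFiniteMeasure ρ]
    {K : Set (Fin ν → ℝ)} (hKc : IsCompact K) (hK : ρ Kᶜ = 0) (hρ : ρ ≠ 0) {β : ℝ} (hβ : 0 ≤ β)
    (hrefl : ∀ e ∈ G.edgeSet, ∃ (θ : V ≃ V) (P : Finset V),
      (∀ x, θ (θ x) = x) ∧ (∀ x y, G.Adj (θ x) (θ y) ↔ G.Adj x y) ∧ (∀ x, x ∈ P ↔ θ x ∉ P) ∧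
      (∀ x y, x ∈ P → y ∉ P → G.Adj x y → y = θ x) ∧ ∃ y ∈ P, G.Adj y (θ y) ∧ e = s(y, θ y))
    (h : V → Fin ν → ℝ) : NVector.vZ G ρ β h ≤ NVector.vZ G ρ β 0 := by
  -- the finite set of fields with values in the range of `h`
  set R : Finset (Fin ν → ℝ) := Finset.univ.image h with hR
  set F : Finset (V → Fin ν → ℝ) := Fintype.piFinset fun _ => R with hF
  have hhF : h ∈ F := by
    rw [hF, Fintype.mem_piFinset]
    intro x
    exact Finset.mem_image_of_mem h (Finset.mem_univ x)
  have hFne : F.Nonempty := ⟨h, hhF⟩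
  -- a maximiser of `Z` on `F`, with the fewest bad bonds among the maximisers
  obtain ⟨g₀, hg₀F, hg₀max⟩ := Finset.exists_max_image F (NVector.vZ G ρ β) hFne
  set Fmax := F.filter fun g => NVector.vZ G ρ β g = NVector.vZ G ρ β g₀ with hFmax
  have hFmaxne : Fmax.Nonempty := ⟨g₀, by simp [hFmax, hg₀F]⟩
  obtain ⟨g, hgFmax, hgmin⟩ := Finset.exists_min_image Fmax (NVector.vbadBonds G) hFmaxne
  obtain ⟨hgF, hgZ⟩ := Finset.mem_filter.1 hgFmax
  have hgmax : ∀ g' ∈ F, NVector.vZ G ρ β g' ≤ NVector.vZ G ρ β g :=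
    fun g' hg' => hgZ ▸ hg₀max g' hg'
  have hgmin' : ∀ g' ∈ F, NVector.vZ G ρ β g' = NVector.vZ G ρ β g →
      NVector.vbadBonds G g ≤ NVector.vbadBonds G g' :=
    fun g' hg' hZ' => hgmin _ (Finset.mem_filter.2 ⟨hg', hZ'.trans hgZ⟩)
  -- claim: `g` has no bad bond
  have hN : NVector.vbadBonds G g = 0 := by
    by_contra hN0
    obtain ⟨e, he, hbad⟩ : ∃ e ∈ G.edgeFinset, NVector.vbadInd g e ≠ 0 := by
      by_contra hall
      push Not at hall
      exact hN0 (Finset.sum_eq_zero hall)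
    obtain ⟨θ, P, hθθ, hadj, hP, hcross, y, hyP, hy, rfl⟩ :=
      hrefl e (SimpleGraph.mem_edgeFinset.1 he)
    rw [NVector.vbadInd_mk] at hbad
    have hgy : g y ≠ g (θ y) := by
      intro h'; rw [if_pos h'] at hbad; exact hbad rfl
    exact hgy (apply_eq_of_crossing (G := G) ρ hKc hK hρ hβ hθθ hadj hP hcross
      (NVector.reflPlus_mem_piFinset hgF) (NVector.reflMinus_mem_piFinset hgF) hgmax hgmin' hyP hy)
  calc NVector.vZ G ρ β h ≤ NVector.vZ G ρ β g := hgmax h hhF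
    _ = NVector.vZ G ρ β 0 := NVector.vZ_eq_vZ_zero_of_vbadBonds_eq_zero ρ β hN

end Descent

section TorusDescent

open MeasureTheory

variable {d d' L M : ℕ} [NeZero L] [NeZero M] {ν : ℕ}

/-- **Every bond of the even product torus is bisected by an admissible reflection**: a bond in a
direction of the first factor by a reflection `θ × id` of the first factor, a bond in a direction of
the second factor by a reflection `id × θ` of the second (Friedli–Velenik 2017, §10.3 reflections
through edges, for each factor; `L, M ≥ 4` even). [cite: FriedliVelenik2017, §10.3 and §10.5.3] -/
theorem boxTorus_edge_reflection (hL : Even L) (hL4 : 4 ≤ L) (hM : Even M) (hM4 : 4 ≤ M)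
    {e : Sym2 (TorusSite d L × TorusSite d' M)}
    (he : e ∈ (torusGraph d L □ torusGraph d' M).edgeSet) :
    ∃ (θ : (TorusSite d L × TorusSite d' M) ≃ (TorusSite d L × TorusSite d' M))
      (P : Finset (TorusSite d L × TorusSite d' M)),
      (∀ x, θ (θ x) = x) ∧
      (∀ x y, (torusGraph d L □ torusGraph d' M).Adj (θ x) (θ y) ↔
        (torusGraph d L □ torusGraph d' M).Adj x y) ∧
      (∀ x, x ∈ P ↔ θ x ∉ P) ∧
      (∀ x y, x ∈ P → y ∉ P → (torusGraph d L □ torusGraph d' M).Adj x y → y = θ x) ∧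
      ∃ y ∈ P, (torusGraph d L □ torusGraph d' M).Adj y (θ y) ∧ e = s(y, θ y) := by
  have hL2 : 2 ≤ L := by omega
  have hM2 : 2 ≤ M := by omega
  rcases boxTorus_edge_cases he with ⟨x, i, rfl⟩ | ⟨x, j, rfl⟩
  · obtain ⟨hθθ, hadj, hP, hcross⟩ := reflect_left_hyps (d' := d') (M := M) hL hL4 i (x.1 i)
    obtain ⟨hyP, hθy⟩ := add_single_left_mem_half (d' := d') (M := M) hL2 i x
    refine ⟨_, _, hθθ, hadj, hP, hcross, (x.1 + Pi.single i 1, x.2), hyP, ?_, ?_⟩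
    · rw [hθy]
      exact (boxTorus_adj_add_single_left hL2 x i).symm
    · rw [hθy, Sym2.eq_swap]
  · obtain ⟨hθθ, hadj, hP, hcross⟩ := reflect_right_hyps (d := d) (L := L) hM hM4 j (x.2 j)
    obtain ⟨hyP, hθy⟩ := add_single_right_mem_half (d := d) (L := L) hM2 j x
    refine ⟨_, _, hθθ, hadj, hP, hcross, (x.1, x.2 + Pi.single j 1), hyP, ?_, ?_⟩
    · rw [hθy]
      exact (boxTorus_adj_add_single_right hM2 x j).symm
    · rw [hθy, Sym2.eq_swap]

/-- **Gaussian domination on the even product torus** (Friedli–Velenik 2017, Prop. 10.27,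
eq. (10.43), `Z(h) ≤ Z(0)`, for the box product `(ℤ/L)^d × (ℤ/M)^{d'}` of two even tori with
`L, M ≥ 4`, `ν`-component spins with a finite nonzero compactly supported single-spin measure,
`β ≥ 0`): the anisotropic analogue of the tree's `NVector.vZ_le_vZ_zero`. [cite: FriedliVelenik2017, Prop. 10.27, eq. (10.43)] -/
theorem vZ_le_vZ_zero_boxTorus [DecidableRel (torusGraph d L □ torusGraph d' M).Adj]
    (hL : Even L) (hL4 : 4 ≤ L) (hM : Even M) (hM4 : 4 ≤ M)
    (ρ : Measure (Fin ν → ℝ)) [IsFiniteMeasure ρ] {K : Set (Fin ν → ℝ)} (hKc : IsCompact K)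
    (hK : ρ Kᶜ = 0) (hρ : ρ ≠ 0) {β : ℝ} (hβ : 0 ≤ β)
    (h : TorusSite d L × TorusSite d' M → Fin ν → ℝ) :
    NVector.vZ (torusGraph d L □ torusGraph d' M) ρ β h ≤
      NVector.vZ (torusGraph d L □ torusGraph d' M) ρ β 0 :=
  vZ_le_vZ_zero_of_reflections ρ hKc hK hρ hβ
    (fun _ he => boxTorus_edge_reflection hL hL4 hM hM4 he) h

end TorusDescent

end BirSliceXY

end Summit.HubbardSuperconductivity.HubbardSuperconductivity.Theorems
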